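import Summits.Parity.GeneralizedHardyLittlewood.Theorems.PrimeLevelFamEdgeMomentsBeyondDiagonalDiagRemDeformedLocalSum
import Summits.Parity.GeneralizedHardyLittlewood.Theorems.PrimeLevelFamEdgeMomentsBeyondDiagonalDiagRemDeformedKernel
import Summits.Parity.GeneralizedHardyLittlewood.Theorems.PrimeLevelFamEdgeMomentsBeyondDiagonalDiagRemConvTailPow
import HarnessLib

/-!
# Route `PrimeLevelFamEdge`, crux K_A `MomentsBeyondDiagonal` (stmt-Parity-20007), line «petersson_layers» v4, stub `stub_diag`:
# **«DRTAIL» for EVERY moment order `r`: `Σ_{k ≤ y} W_n(k)·Σ_{de=k}(log d − log e)^r = c_{n,r} + O_{r,A}(D(n)(1 + log y)⁻ᴬ)`**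
# (the generic form of (P2TAIL)/(D4TAIL): the analytic input of EVERY both-sided remainder monomial, at every order)

`W_n = 1_{(·,n)=1}μ/(id·ψ)`, and on squarefree `k` (the support of `W_n`) `Σ_{de=k}(log d − log e)^r = τ(k)·𝔼[(Σ_{p∣k}ε_p log p)^r]`, so the
summand is `a_n(k)·m_r(k)` with `a_n = copTauW n` and `m_r` the `r`-th Rademacher moment — `m₀ = 1`, `m₂ = P₂`, `m₄ = D₄ = 3P₂² − 2P₄`,
`m₆ = 15P₂³ − 30P₂P₄ + 16P₆`, `m₈ = 105P₂⁴ − 420P₂²P₄ + 448P₂P₆ + 140P₄² − 272P₈`, …: exactly the central-moment kinds `U, S2, Q, X, Z, …` of the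
order-`(i,j)` remainder weight tables (`Cruxes/…/Lines/petersson_layers_stub_diag_g16_order44.md`). Hence this file supplies, once and for all
orders, the convergent-partial-sum input that the both-sided monomials `m_r ⊗ m_s · R` need (for `r = 2` it re-proves (P2TAIL)_A, for `r = 4`
(D4TAIL)_A of `…DiagRemD4TailBoundPow`, up to the pointwise Rademacher identity of `…DiagRemRademacher`).

Same `t`-deformation proof as `…DiagRemDeformedIdentity` / `…DiagRemD4TailBoundPow`, with the `Xʳ`-coefficient in place of `X⁴`:

* `sum_Wn_logDiff_pow_eq_deformed` — `Σ_{k≤N} W_n(k)S_r(k) = Σ_{m≤N}Σ_{i≤r} C(r,i)·η_n^{(i)}(m)·Σ_{j≤N/m} β_{r−i}(j)`;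
* `abs_sum_Wn_logDiff_pow_sub_le_pow` — **(«DRTAIL»_{r,A}) ∀ r A ∃ C ∀ n ≥ 1 ∃ c_n, |c_n| ≤ C·D(n),
  |Σ_{k ≤ y} W_n(k)Σ_{de=k}(log d − log e)^r − c_n| ≤ C·D(n)/(1 + log y)ᴬ (y ≥ 1).**

Def-free; theorems only. Helper `--supports stmt-Parity-20007`; closes nothing; K_A, K_B and the Parity summit are NOT proved;
nothing about Landau–Siegel zeros.

## References
* E. Kowalski, P. Michel, J. VanderKam, J. reine angew. Math. 526 (2000), Prop. 5.1 p. 18.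
  [cite: KowalskiMichelVanderKam2000, Prop. 5.1 — derivation (decorated Selberg coefficients, every order)]
-/

noncomputable section

open Finset Real ArithmeticFunction

namespace Summit.Parity.GeneralizedHardyLittlewood.Theorems.MomentsBeyondDiagonal.DiagCorner

open Literature.NumberTheory.LFunctions.KMV2000.MollifierMainTerm (W G invA)
open Summit.Parity.GeneralizedHardyLittlewood.Theorems.BeyondDiagonalBeatsQuarter.KernelFormXSq
  (copTauW divWeight divWeight_nonneg G_mul_invA)
open Literature.NumberTheory.LFunctions.SiegelWalfiszLiouville (sum_Ioc_sum_divisorsAntidiagonal_eq)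
open Literature.Barriers.Parity (Icc_one_eq_Ioc_zero)

/-- `r!·[Xʳ]𝔄_n(k) = W_n(k)·Σ_{de=k}(log d − log e)^r`. [folklore] -/
theorem coeff_frakA_gen (n r : ℕ) (frakA : ArithmeticFunction (PowerSeries ℝ))
    (hA : ∀ k : ℕ, frakA k = PowerSeries.C (if k.Coprime n then W k else 0) *
      ∑ z ∈ k.divisorsAntidiagonal, PowerSeries.rescale (1 * Real.log z.1) (PowerSeries.exp ℝ) *
        PowerSeries.rescale (-1 * Real.log z.2) (PowerSeries.exp ℝ)) (k : ℕ) :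
    (r.factorial : ℝ) * PowerSeries.coeff r (frakA k) =
      (if k.Coprime n then W k else 0) * ∑ z ∈ k.divisorsAntidiagonal, (Real.log z.1 - Real.log z.2) ^ r := by
  rw [hA, PowerSeries.coeff_C_mul, map_sum, Finset.mul_sum, Finset.mul_sum, Finset.mul_sum]
  refine Finset.sum_congr rfl fun z _ ↦ ?_
  rw [expWeight_mul, coeff_rescale_exp]
  have : (r.factorial : ℝ) ≠ 0 := by positivity
  field_simp
  ring

set_option maxHeartbeats 1600000 in
/-- **The `t`-deformed rearrangement at moment order `r`**:
`Σ_{k≤N} W_n(k)S_r(k) = Σ_{m≤N}Σ_{i≤r} C(r,i)·η_n^{(i)}(m)·Σ_{j≤N/m}Σ_{de=j} G(d)G(e)(log d − log e)^{r−i}`.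
[cite: KowalskiMichelVanderKam2000, Prop. 5.1 — derivation (decorated Selberg coefficients, every order)] -/
theorem sum_Wn_logDiff_pow_eq_deformed (n r N : ℕ) :
    ∑ k ∈ Icc 1 N, (if k.Coprime n then W k else 0) * ∑ z ∈ k.divisorsAntidiagonal, (Real.log z.1 - Real.log z.2) ^ r =
      ∑ m ∈ Icc 1 N, ∑ i ∈ Finset.range (r + 1), (Nat.choose r i : ℝ) *
        (∑ y ∈ m.divisorsAntidiagonal, ∑ x ∈ y.1.divisorsAntidiagonal, ∑ z ∈ y.2.divisorsAntidiagonal,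
          (x.1 : ℝ)⁻¹ * (x.2 : ℝ)⁻¹ * (if y.2.Coprime n then W y.2 else 0) *
            (Real.log x.1 - Real.log x.2 + (Real.log z.1 - Real.log z.2)) ^ i) *
        ∑ j ∈ Icc 1 (N / m), ∑ x ∈ j.divisorsAntidiagonal,
          G x.1 * G x.2 * (Real.log x.1 - Real.log x.2) ^ (r - i) := by
  classical
  -- the deformed objects
  set GE : ArithmeticFunction (PowerSeries ℝ) :=
    ⟨fun d ↦ PowerSeries.C (G d) * PowerSeries.rescale (1 * Real.log d) (PowerSeries.exp ℝ), by simp⟩ with hGEdef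
  set GEm : ArithmeticFunction (PowerSeries ℝ) :=
    ⟨fun d ↦ PowerSeries.C (G d) * PowerSeries.rescale (-1 * Real.log d) (PowerSeries.exp ℝ), by simp⟩ with hGEmdef
  set AE : ArithmeticFunction (PowerSeries ℝ) :=
    ⟨fun d ↦ PowerSeries.C ((d : ℝ)⁻¹) * PowerSeries.rescale (1 * Real.log d) (PowerSeries.exp ℝ), by simp⟩ with hAEdef
  set AEm : ArithmeticFunction (PowerSeries ℝ) :=
    ⟨fun d ↦ PowerSeries.C ((d : ℝ)⁻¹) * PowerSeries.rescale (-1 * Real.log d) (PowerSeries.exp ℝ), by simp⟩ with hAEmdef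
  set frakA : ArithmeticFunction (PowerSeries ℝ) :=
    ⟨fun k ↦ PowerSeries.C (if k.Coprime n then W k else 0) *
      ∑ z ∈ k.divisorsAntidiagonal, PowerSeries.rescale (1 * Real.log z.1) (PowerSeries.exp ℝ) *
        PowerSeries.rescale (-1 * Real.log z.2) (PowerSeries.exp ℝ), by simp⟩ with hAdef
  have hGE : ∀ d : ℕ, GE d = PowerSeries.C (G d) * PowerSeries.rescale (1 * Real.log d) (PowerSeries.exp ℝ) := fun d ↦ rfl
  have hGEm : ∀ d : ℕ, GEm d = PowerSeries.C (G d) * PowerSeries.rescale (-1 * Real.log d) (PowerSeries.exp ℝ) := fun d ↦ rfl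
  have hAE : ∀ d : ℕ, AE d = PowerSeries.C ((d : ℝ)⁻¹) * PowerSeries.rescale (1 * Real.log d) (PowerSeries.exp ℝ) := fun d ↦ rfl
  have hAEm : ∀ d : ℕ, AEm d = PowerSeries.C ((d : ℝ)⁻¹) * PowerSeries.rescale (-1 * Real.log d) (PowerSeries.exp ℝ) :=
    fun d ↦ rfl
  have hA : ∀ k : ℕ, frakA k = PowerSeries.C (if k.Coprime n then W k else 0) *
      ∑ z ∈ k.divisorsAntidiagonal, PowerSeries.rescale (1 * Real.log z.1) (PowerSeries.exp ℝ) *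
        PowerSeries.rescale (-1 * Real.log z.2) (PowerSeries.exp ℝ) := fun k ↦ rfl
  -- `B ∗ H = 𝔄`
  have h1 : GE * AE = 1 := GE_mul_AE_eq_one 1 GE AE hGE hAE
  have h2 : GEm * AEm = 1 := GE_mul_AE_eq_one (-1) GEm AEm hGEm hAEm
  have hBH : (AE * AEm * frakA) * (GE * GEm) = frakA := by
    calc (AE * AEm * frakA) * (GE * GEm) = (GE * AE) * (GEm * AEm) * frakA := by ring
      _ = frakA := by rw [h1, h2, one_mul, one_mul]
  have hBi : ∀ j i : ℕ, (i.factorial : ℝ) * PowerSeries.coeff i ((GE * GEm) j) =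
      ∑ x ∈ j.divisorsAntidiagonal, G x.1 * G x.2 * (Real.log x.1 - Real.log x.2) ^ i := by
    intro j i
    rw [coeff_B GE GEm hGE hGEm j i, Finset.mul_sum]
    refine Finset.sum_congr rfl fun x _ ↦ ?_
    have : (i.factorial : ℝ) ≠ 0 := by positivity
    field_simp
  -- pointwise in `k`
  have hpt : ∀ k : ℕ, (if k.Coprime n then W k else 0) * ∑ z ∈ k.divisorsAntidiagonal, (Real.log z.1 - Real.log z.2) ^ r =
      ∑ y ∈ k.divisorsAntidiagonal, ∑ i ∈ Finset.range (r + 1), (Nat.choose r i : ℝ) *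
        ((i.factorial : ℝ) * PowerSeries.coeff i ((AE * AEm * frakA) y.1)) *
          (((r - i).factorial : ℝ) * PowerSeries.coeff (r - i) ((GE * GEm) y.2)) := by
    intro k
    rw [← coeff_frakA_gen n r frakA hA k, show frakA k = ((AE * AEm * frakA) * (GE * GEm)) k by rw [hBH], mul_apply, map_sum,
      Finset.mul_sum]
    refine Finset.sum_congr rfl fun y _ ↦ ?_
    rw [PowerSeries.coeff_mul, Finset.Nat.sum_antidiagonal_eq_sum_range_succ
      (fun i j ↦ PowerSeries.coeff i ((AE * AEm * frakA) y.1) * PowerSeries.coeff j ((GE * GEm) y.2)) r, Finset.mul_sum]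
    refine Finset.sum_congr rfl fun i hi ↦ ?_
    have hi' : i ≤ r := Nat.lt_succ_iff.mp (Finset.mem_range.mp hi)
    have hchoose : (r.factorial : ℝ) = (Nat.choose r i : ℝ) * (i.factorial * (r - i).factorial) := by
      rw [← Nat.choose_mul_factorial_mul_factorial hi']; push_cast; ring
    rw [hchoose]
    ring
  -- sum over `k ≤ N` and pass to `(m, j ≤ N/m)`
  rw [Finset.sum_congr rfl fun k _ ↦ hpt k, Icc_one_eq_Ioc_zero]
  rw [sum_Ioc_sum_divisorsAntidiagonal_eq (fun m j ↦ ∑ i ∈ Finset.range (r + 1), (Nat.choose r i : ℝ) *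
        ((i.factorial : ℝ) * PowerSeries.coeff i ((AE * AEm * frakA) m)) *
          (((r - i).factorial : ℝ) * PowerSeries.coeff (r - i) ((GE * GEm) j))) N, ← Icc_one_eq_Ioc_zero]
  refine Finset.sum_congr rfl fun m _ ↦ ?_
  rw [← Icc_one_eq_Ioc_zero, Finset.sum_comm]
  refine Finset.sum_congr rfl fun i _ ↦ ?_
  rw [Finset.mul_sum]
  refine Finset.sum_congr rfl fun j _ ↦ ?_
  rw [coeff_H n AE AEm frakA hAE hAEm hA i m, hBi j (r - i)]

set_option maxHeartbeats 1600000 in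
/-- **(«DRTAIL»_{r,A}).** For all `r A` there is `C ≥ 0` such that for every `n ≥ 1` there is `c_n` with `|c_n| ≤ C·D(n)` and
`|Σ_{k ≤ y} W_n(k)·Σ_{de=k}(log d − log e)^r − c_n| ≤ C·D(n)/(1 + log y)ᴬ` for all `y ≥ 1`.
[cite: KowalskiMichelVanderKam2000, Prop. 5.1 — derivation (decorated Selberg coefficients, every order)] -/
theorem abs_sum_Wn_logDiff_pow_sub_le_pow (r A : ℕ) :
    ∃ C : ℝ, 0 ≤ C ∧ ∀ n : ℕ, n ≠ 0 → ∃ c : ℝ, |c| ≤ C * divWeight n ∧ ∀ y : ℝ, 1 ≤ y →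
      |(∑ k ∈ Icc 1 ⌊y⌋₊, (if k.Coprime n then W k else 0) *
          ∑ z ∈ k.divisorsAntidiagonal, (Real.log z.1 - Real.log z.2) ^ r) - c| ≤
        C * divWeight n / (1 + Real.log y) ^ A := by
  classical
  -- inputs
  obtain ⟨CT, hCT0, hCT⟩ := exists_convTail_const A
  have hker := fun i : ℕ ↦ exists_abs_sum_G_logDiff_kernel_sub_le_pow i
  choose κ hκ using hker
  have hkerA := fun i : ℕ ↦ hκ i A
  choose K hK0 hK using hkerA
  have hloc := fun c : ℕ ↦ exists_summable_abs_eta_mul_rpow c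
  choose Cη hCη0 hCη using hloc
  -- the constant
  set C : ℝ := ∑ i ∈ Finset.range (r + 1), (Nat.choose r i : ℝ) * ((CT + 1) * (K (r - i) + |κ (r - i)|) * Cη i) with hCdef
  have hC0 : 0 ≤ C := Finset.sum_nonneg fun i _ ↦ by
    have := hK0 (r - i); have := hCη0 i; positivity
  refine ⟨C, hC0, fun n hn ↦ ?_⟩
  set D : ℝ := divWeight n with hDdef
  have hD0 : 0 ≤ D := divWeight_nonneg n
  -- the local factors `η^{(c)}` and their data
  set η : ℕ → ℕ → ℝ := fun c m ↦ ∑ y ∈ m.divisorsAntidiagonal, ∑ x ∈ y.1.divisorsAntidiagonal,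
      ∑ z ∈ y.2.divisorsAntidiagonal,
        (x.1 : ℝ)⁻¹ * (x.2 : ℝ)⁻¹ * (if y.2.Coprime n then W y.2 else 0) *
          (Real.log x.1 - Real.log x.2 + (Real.log z.1 - Real.log z.2)) ^ c with hηdef
  have hη0 : ∀ c, η c 0 = 0 := fun c ↦ by simp [hηdef]
  have hηs : ∀ c, Summable fun m : ℕ ↦ |η c m| * (m : ℝ) ^ (1 / 16 : ℝ) := fun c ↦ (hCη c n hn).1
  have hηM : ∀ c, ∑' m : ℕ, |η c m| * (m : ℝ) ^ (1 / 16 : ℝ) ≤ Cη c * D := fun c ↦ (hCη c n hn).2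
  have hηabs : ∀ c, Summable fun m : ℕ ↦ |η c m| := fun c ↦ summable_abs_of_summable_abs_mul_rpow (hη0 c) (hηs c)
  have hηtsum : ∀ c, |∑' m : ℕ, η c m| ≤ Cη c * D := by
    intro c
    calc |∑' m : ℕ, η c m| ≤ ∑' m : ℕ, |η c m| := by
          have := norm_tsum_le_tsum_norm (f := fun m : ℕ ↦ η c m) (by simpa [Real.norm_eq_abs] using hηabs c)
          simpa [Real.norm_eq_abs] using this
      _ ≤ ∑' m : ℕ, |η c m| * (m : ℝ) ^ (1 / 16 : ℝ) := by
          refine (hηabs c).tsum_le_tsum (fun m ↦ ?_) (hηs c)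
          rcases Nat.eq_zero_or_pos m with rfl | hm
          · simp [hη0 c]
          · exact le_mul_of_one_le_right (abs_nonneg _) (Real.one_le_rpow (by exact_mod_cast hm) (by norm_num))
      _ ≤ Cη c * D := hηM c
  -- the kernels `β_i`
  set β : ℕ → ℕ → ℝ := fun i j ↦ ∑ x ∈ j.divisorsAntidiagonal, G x.1 * G x.2 * (Real.log x.1 - Real.log x.2) ^ i with hβdef
  -- the constant `c_n`
  refine ⟨∑ i ∈ Finset.range (r + 1), (Nat.choose r i : ℝ) * (κ (r - i) * ∑' m : ℕ, η i m), ?_, fun y hy ↦ ?_⟩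
  · -- `|c_n| ≤ C·D`
    calc |∑ i ∈ Finset.range (r + 1), (Nat.choose r i : ℝ) * (κ (r - i) * ∑' m : ℕ, η i m)|
        ≤ ∑ i ∈ Finset.range (r + 1), |(Nat.choose r i : ℝ) * (κ (r - i) * ∑' m : ℕ, η i m)| := Finset.abs_sum_le_sum_abs _ _
      _ ≤ ∑ i ∈ Finset.range (r + 1), (Nat.choose r i : ℝ) * ((CT + 1) * (K (r - i) + |κ (r - i)|) * Cη i) * D := by
          refine Finset.sum_le_sum fun i _ ↦ ?_
          rw [abs_mul, abs_mul, Nat.abs_cast]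
          have h1 : |κ (r - i)| * |∑' m : ℕ, η i m| ≤ |κ (r - i)| * (Cη i * D) :=
            mul_le_mul_of_nonneg_left (hηtsum i) (abs_nonneg _)
          have h2 : |κ (r - i)| * (Cη i * D) ≤ ((CT + 1) * (K (r - i) + |κ (r - i)|) * Cη i) * D := by
            have hK := hK0 (r - i); have hCη' := hCη0 i
            have : |κ (r - i)| ≤ (CT + 1) * (K (r - i) + |κ (r - i)|) := by nlinarith [abs_nonneg (κ (r - i))]
            nlinarith [abs_nonneg (κ (r - i)), mul_nonneg hCη' hD0]
          calc (Nat.choose r i : ℝ) * (|κ (r - i)| * |∑' m : ℕ, η i m|)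
              ≤ (Nat.choose r i : ℝ) * (((CT + 1) * (K (r - i) + |κ (r - i)|) * Cη i) * D) :=
                mul_le_mul_of_nonneg_left (h1.trans h2) (Nat.cast_nonneg _)
            _ = _ := by ring
      _ = C * D := by rw [hCdef, Finset.sum_mul]
  · -- the tail estimate
    have hy0 : 0 < y := by linarith
    have hL : 0 < (1 + Real.log y) ^ A := pow_pos (by linarith [Real.log_nonneg hy]) A
    rw [sum_Wn_logDiff_pow_eq_deformed n r ⌊y⌋₊]
    -- rewrite the identity's right-hand side with `η`, `β` and swap the sums
    have hre : (∑ m ∈ Icc 1 ⌊y⌋₊, ∑ i ∈ Finset.range (r + 1), (Nat.choose r i : ℝ) * η i m *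
        ∑ j ∈ Icc 1 (⌊y⌋₊ / m), β (r - i) j) =
        ∑ i ∈ Finset.range (r + 1), (Nat.choose r i : ℝ) * ∑ m ∈ Icc 1 ⌊y⌋₊, η i m * ∑ j ∈ Icc 1 (⌊y⌋₊ / m), β (r - i) j := by
      rw [Finset.sum_comm]
      refine Finset.sum_congr rfl fun i _ ↦ ?_
      rw [Finset.mul_sum]
      exact Finset.sum_congr rfl fun m _ ↦ by ring
    rw [show (∑ m ∈ Icc 1 ⌊y⌋₊, ∑ i ∈ Finset.range (r + 1), (Nat.choose r i : ℝ) *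
        (∑ y ∈ m.divisorsAntidiagonal, ∑ x ∈ y.1.divisorsAntidiagonal, ∑ z ∈ y.2.divisorsAntidiagonal,
          (x.1 : ℝ)⁻¹ * (x.2 : ℝ)⁻¹ * (if y.2.Coprime n then W y.2 else 0) *
            (Real.log x.1 - Real.log x.2 + (Real.log z.1 - Real.log z.2)) ^ i) *
        ∑ j ∈ Icc 1 (⌊y⌋₊ / m), ∑ x ∈ j.divisorsAntidiagonal,
          G x.1 * G x.2 * (Real.log x.1 - Real.log x.2) ^ (r - i)) =
        ∑ m ∈ Icc 1 ⌊y⌋₊, ∑ i ∈ Finset.range (r + 1), (Nat.choose r i : ℝ) * η i m * ∑ j ∈ Icc 1 (⌊y⌋₊ / m), β (r - i) j from rfl,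
      hre, ← Finset.sum_sub_distrib]
    -- termwise: the abstract convolution tail
    have hterm : ∀ i ∈ Finset.range (r + 1),
        |(Nat.choose r i : ℝ) * ∑ m ∈ Icc 1 ⌊y⌋₊, η i m * ∑ j ∈ Icc 1 (⌊y⌋₊ / m), β (r - i) j -
          (Nat.choose r i : ℝ) * (κ (r - i) * ∑' m : ℕ, η i m)| ≤
        (Nat.choose r i : ℝ) * (((CT + 1) * (K (r - i) + |κ (r - i)|) * Cη i) * D / (1 + Real.log y) ^ A) := by
      intro i _
      have h := hCT (β (r - i)) (η i) (κ (r - i)) (K (r - i)) (Cη i * D) (hK0 (r - i)) (hK (r - i)) (hη0 _) (hηs _) (hηM _) y hy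
      rw [← mul_sub, abs_mul, Nat.abs_cast]
      refine mul_le_mul_of_nonneg_left (h.trans ?_) (Nat.cast_nonneg _)
      rw [div_le_div_iff_of_pos_right hL]
      have hK := hK0 (r - i); have hCη' := hCη0 i
      have h3 : 0 ≤ (K (r - i) + |κ (r - i)|) * (Cη i * D) := by positivity
      nlinarith
    calc |∑ i ∈ Finset.range (r + 1), ((Nat.choose r i : ℝ) * ∑ m ∈ Icc 1 ⌊y⌋₊, η i m * ∑ j ∈ Icc 1 (⌊y⌋₊ / m), β (r - i) j -
          (Nat.choose r i : ℝ) * (κ (r - i) * ∑' m : ℕ, η i m))|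
        ≤ ∑ i ∈ Finset.range (r + 1), |(Nat.choose r i : ℝ) * ∑ m ∈ Icc 1 ⌊y⌋₊, η i m * ∑ j ∈ Icc 1 (⌊y⌋₊ / m), β (r - i) j -
          (Nat.choose r i : ℝ) * (κ (r - i) * ∑' m : ℕ, η i m)| := Finset.abs_sum_le_sum_abs _ _
      _ ≤ ∑ i ∈ Finset.range (r + 1), (Nat.choose r i : ℝ) * (((CT + 1) * (K (r - i) + |κ (r - i)|) * Cη i) * D / (1 + Real.log y) ^ A) :=
          Finset.sum_le_sum hterm
      _ = C * D / (1 + Real.log y) ^ A := by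
          rw [hCdef, Finset.sum_mul, Finset.sum_div]
          exact Finset.sum_congr rfl fun i _ ↦ by ring

end Summit.Parity.GeneralizedHardyLittlewood.Theorems.MomentsBeyondDiagonal.DiagCorner

end
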